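import Literature.AlgebraicGeometry.Morphisms.CechH1
import Mathlib.AlgebraicGeometry.Morphisms.Flat
import Mathlib.RingTheory.Flat.TorsionFree
import Mathlib.RingTheory.Noetherian.Basic

/-!
# Formal functions from the finiteness of `H¹`: surjectivity of `Γ(X, 𝒪)^∧ → lim Γ(X_n, 𝒪)`

Sibling proofs file of `Literature/AlgebraicGeometry/Morphisms/FormalFunctions.lean` and
`Literature/AlgebraicGeometry/Morphisms/CechH1.lean`. We prove the surjectivity half of the
theorem on formal functions for `H⁰` (The Stacks Project, Tag 02OC, case `p = 0`, `𝓕 = 𝒪_X`),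
`Literature.AlgGeom.HasSurjectiveFormalFunctions (π) f`, for a scheme `f : X → Spec A` over a
Noetherian ring `A` which is flat over `A`, the principal ideal `I = (π)` of a non-zero-divisor
`π` (e.g. a uniformiser of a discrete valuation ring), and a finite affine open cover `𝒰` of `X`
whose Čech cohomology `Ȟ¹(𝒰, 𝒪_X)` is a finitely generated `A`-module
(`hasSurjectiveFormalFunctions_of_finite_cechH1`). Combined with the named fact
`Literature.AlgebraicGeometry.Morphisms.cechH1_finite` (Tag 02O5: finiteness of `H¹(X, 𝒪_X)` for `X` proper over `A`) this
gives `HasSurjectiveFormalFunctions (π) f` for `f` proper and flat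
(`hasSurjectiveFormalFunctions_of_cechH1_finite`); the injectivity half
`HasInjectiveFormalFunctions (π) f` holds for any flat `f` (`hasInjectiveFormalFunctions_of_flat`),
so that for `f` proper and flat the whole instance of the theorem on formal functions for `H⁰`
and `I = (π)` follows from `cechH1_finite` (`formalFunctions_H0_of_cechH1_finite`).

## The argument (EGA III₁ 4.1.7 / Hartshorne III.11.1 in the flat principal case, by hand)

Since `X` is flat over `A` and `π` is a non-zero-divisor, `π` is a non-zero-divisor on every
`Γ(X, V)` (`Sections.isSMulRegular`), and for an affine open `W` the closed subscheme
`W_n = W ×_A A/π^{n+1}` of the infinitesimal neighbourhood `X_n` has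
`Γ(W_n, 𝒪) = Γ(X, W) / π^{n+1} Γ(X, W)` (`mem_map_of_app_ι_eq_zero`, from Mathlib's affine base
change `isIso_pushoutSection_of_isAffineOpen`, and Mathlib's surjectivity for closed immersions).
Given `s ∈ Γ(X_n, 𝒪)`, lift `s |_{(U_i)_n}` to `m_i ∈ Γ(X, U_i)`; then `m_j - m_i` vanishes on
`(U_i ∩ U_j)_n`, so `m_j - m_i = π^{n+1} c_{ij}` for a unique Čech `1`-cocycle `c` (`LiftData`,
`CechH1.lean`; existence here: `LiftData.nonempty`),
whose class `x_n(s) ∈ Ȟ¹(𝒰, 𝒪_X)` does not depend on the choices, is killed by `π^{n+1}`, and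
vanishes iff `s` lifts to `Γ(X, 𝒪_X)` (`LiftData.exists_restrict_eq`: correct the `m_i` by
`π^{n+1} b_i` and glue). For a compatible family `(s_n)` one has `x_n = π · x_{n+1}`
(`LiftData.ofSucc`), hence `x_n = π^j x_{n+j}` for all `j`; as `Ȟ¹` is Noetherian its `π`-power
torsion is killed by a fixed `π^e`, so `x_n = π^e · x_{n+e} = 0`: every `s_n` lifts to some
`m̃_n ∈ Γ(X, 𝒪_X)`, and `m̃_{n+1} - m̃_n` vanishes on `X_n`, i.e. lies in `π^{n+1} Γ(X, 𝒪_X)`.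
This is the connecting-homomorphism argument `H⁰(𝒪_{X_n}) → H¹(𝒪_X)[π^{n+1}]` for the exact
sequences `0 → 𝒪_X → 𝒪_X → 𝒪_{X_n} → 0`, written out with Čech cocycles.

## References

* The Stacks Project, Tag 02OC (Cohomology of Schemes, Theorem 30.20.5) and Tag 02O5
  (Proposition 30.19.1).
* A. Grothendieck, EGA III₁, 4.1.5–4.1.7.
* R. Hartshorne, *Algebraic Geometry*, Theorem III.11.1 and its proof.
-/

noncomputable section

open CategoryTheory AlgebraicGeometry Limits TopologicalSpace Opposite

universe u v

namespace Literature.AlgebraicGeometry.Morphisms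

open infinitesimalNeighbourhood

variable {A : Type u} [CommRing A] {X : Scheme.{u}} (f : X ⟶ Spec (.of A))

/-! ### Affine opens contained in an open -/

/-- The affine opens contained in an open `V` cover `V`. [folklore] -/
theorem iSup_affineOpens_le (V : X.Opens) :
    ⨆ W : {W : X.affineOpens // (W : X.Opens) ≤ V}, ((W : X.affineOpens) : X.Opens) = V := by
  refine le_antisymm (iSup_le fun W ↦ W.2) fun x hx ↦ ?_
  obtain ⟨_, ⟨W, hW, rfl⟩, hxW, hWV⟩ :=
    X.isBasis_affineOpens.exists_subset_of_mem_open hx V.isOpen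
  exact Opens.mem_iSup.mpr ⟨⟨⟨W, hW⟩, hWV⟩, hxW⟩

/-! ### Flatness: a non-zero-divisor of `A` is a non-zero-divisor on all `Γ(X, V)` -/

/-- Sections of a flat `A`-scheme over an affine open form a flat `A`-module. [folklore] -/
theorem Sections.flat [Flat f] {V : X.Opens} (hV : IsAffineOpen V) :
    Module.Flat A (Sections f V) := by
  have h1 : (f.appLE ⊤ V le_top).hom.Flat := f.flat_appLE (isAffineOpen_top _) hV le_top
  have h2 : ((f.appLE ⊤ V le_top).hom.comp (Scheme.ΓSpecIso (.of A)).inv.hom).Flat :=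
    RingHom.Flat.comp (RingHom.Flat.of_bijective
      (Scheme.ΓSpecIso (.of A)).symm.commRingCatIsoToRingEquiv.bijective) h1
  have e : (f.appLE ⊤ V le_top).hom.comp (Scheme.ΓSpecIso (.of A)).inv.hom =
      algebraMap A (Sections f V) := by
    ext a
    change (f.app ⊤ ≫ X.presheaf.map (homOfLE _).op) ((Scheme.ΓSpecIso (.of A)).inv a) = _
    rfl
  rw [e] at h2
  exact (RingHom.flat_algebraMap_iff.mp h2)

/-- On a flat `A`-scheme, a non-zero-divisor `π ∈ A` is a non-zero-divisor on `Γ(X, V)` for every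
open `V` (affine `V`: flat modules are torsion-free, Mathlib
`Module.Flat.isSMulRegular_of_nonZeroDivisors`; general `V`: locality). [folklore] -/
theorem Sections.isSMulRegular [Flat f] {π : A} (hπ : π ∈ nonZeroDivisors A) (V : X.Opens) :
    IsSMulRegular (Sections f V) π := by
  have haff : ∀ W : X.Opens, IsAffineOpen W → IsSMulRegular (Sections f W) π := fun W hW ↦ by
    haveI := Sections.flat f hW
    exact Module.Flat.isSMulRegular_of_nonZeroDivisors hπ
  intro s t hst
  apply X.sheaf.eq_of_locally_eq' (fun W : {W : X.affineOpens // (W : X.Opens) ≤ V} ↦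
    ((W : X.affineOpens) : X.Opens)) V (fun W ↦ homOfLE W.2) (iSup_affineOpens_le V).ge
  intro W
  change Sections.res f W.2 s = Sections.res f W.2 t
  apply haff _ W.1.2
  change π • Sections.res f W.2 s = π • Sections.res f W.2 t
  rw [← map_smul, ← map_smul]
  exact congrArg _ hst

/-- Local-to-global divisibility by a non-zero-divisor: if `t ∈ Γ(X, V)` is divisible by `a ∈ A`
on every affine open `W ⊆ V` and `a` is a non-zero-divisor on all `Γ(X, W)`, then `t` is
(uniquely) divisible by `a` on `V` (the local quotients are unique, hence glue). [folklore] -/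
theorem Sections.exists_eq_smul_of_forall_affine {a : A}
    (ha : ∀ W : X.Opens, IsSMulRegular (Sections f W) a) {V : X.Opens} (t : Sections f V)
    (h : ∀ W : X.affineOpens, ∀ hW : (W : X.Opens) ≤ V,
      ∃ c : Sections f W, Sections.res f hW t = a • c) :
    ∃ c : Sections f V, t = a • c := by
  choose c hc using h
  let J := {W : X.affineOpens // (W : X.Opens) ≤ V}
  have hcompat : TopCat.Presheaf.IsCompatible X.presheaf
      (fun W : J ↦ ((W : X.affineOpens) : X.Opens)) (fun W ↦ c W.1 W.2) := by
    intro W W'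
    change Sections.res f inf_le_left (c W.1 W.2) = Sections.res f inf_le_right (c W'.1 W'.2)
    apply ha
    change a • Sections.res f _ (c W.1 W.2) = a • Sections.res f _ (c W'.1 W'.2)
    rw [← map_smul, ← map_smul, ← hc, ← hc, Sections.res_res, Sections.res_res]
  obtain ⟨g, hg, -⟩ := X.sheaf.existsUnique_gluing' (fun W : J ↦ ((W : X.affineOpens) : X.Opens))
    V (fun W ↦ homOfLE W.2) (iSup_affineOpens_le V).ge (fun W ↦ c W.1 W.2) hcompat
  let g' : Sections f V := g
  refine ⟨g', ?_⟩
  apply X.sheaf.eq_of_locally_eq' (fun W : J ↦ ((W : X.affineOpens) : X.Opens)) V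
    (fun W ↦ homOfLE W.2) (iSup_affineOpens_le V).ge
  intro W
  change Sections.res f W.2 t = Sections.res f W.2 (a • g')
  rw [map_smul, hc W.1 W.2]
  congr 1
  exact (hg W).symm

/-! ### The infinitesimal neighbourhoods over affine opens -/

section Local

variable (I : Ideal A)

/-- **`Γ((W)_n, 𝒪) = Γ(X, W) / I^{n+1} Γ(X, W)` for affine `W`** (kernel part): a function on an
affine open `W ⊆ X` whose restriction to `W_n = ι_n⁻¹(W) ⊆ X_n = X ×_A A/I^{n+1}` vanishes lies in
`I^{n+1} Γ(X, W)` — `Γ(X_n, ι_n⁻¹ W)` is the pushout `Γ(X, W) ⊗_A A/I^{n+1}` (Mathlib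
`isIso_pushoutSection_of_isAffineOpen`, affine base change of sections), which maps to
`Γ(X, W) / I^{n+1} Γ(X, W)` compatibly. [folklore] -/
theorem mem_map_of_app_ι_eq_zero (n : ℕ) {W : X.Opens} (hW : IsAffineOpen W) (b : Sections f W)
    (hb : ((ι I f n).app W).hom b = 0) :
    b ∈ (I ^ (n + 1)).map (algebraMap A (Sections f W)) := by
  -- the affine base-change square of sections
  have H : IsPullback (ι I f n) (toSpec I f n) f (base I n) := IsPullback.of_hasPullback _ _
  have hsq := (isIso_pushoutSection_iff H (US := ⊤) (UT := ⊤) (UX := W)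
    (UY := (ι I f n) ⁻¹ᵁ W ⊓ (toSpec I f n) ⁻¹ᵁ ⊤) le_top le_top rfl).mp
    (isIso_pushoutSection_of_isAffineOpen H le_top le_top rfl (isAffineOpen_top _)
      (isAffineOpen_top _) hW)
  -- the comparison maps to `Γ(X, W) / I^{n+1} Γ(X, W)`
  set J : Ideal (Sections f W) := (I ^ (n + 1)).map (algebraMap A (Sections f W)) with hJ
  let k₁ : Γ(X, W) ⟶ CommRingCat.of (Sections f W ⧸ J) := CommRingCat.ofHom (Ideal.Quotient.mk J)
  have hI : ∀ a ∈ I ^ (n + 1), (Ideal.Quotient.mk J).comp (algebraMap A (Sections f W)) a = 0 :=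
    fun a ha ↦ Ideal.Quotient.eq_zero_iff_mem.mpr (Ideal.mem_map_of_mem _ ha)
  let k₂ : Γ(Spec (.of (A ⧸ I ^ (n + 1))), ⊤) ⟶ CommRingCat.of (Sections f W ⧸ J) :=
    (Scheme.ΓSpecIso (.of (A ⧸ I ^ (n + 1)))).hom ≫
      CommRingCat.ofHom (Ideal.Quotient.lift (I ^ (n + 1))
        ((Ideal.Quotient.mk J).comp (algebraMap A (Sections f W))) hI)
  have hcomm : f.appLE ⊤ W le_top ≫ k₁ = (base I n).appLE ⊤ ⊤ le_top ≫ k₂ := by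
    have epi : Epi (Scheme.ΓSpecIso (.of A)).inv := inferInstance
    rw [← cancel_epi (Scheme.ΓSpecIso (.of A)).inv]
    ext a
    change Ideal.Quotient.mk J ((f.app ⊤ ≫ X.presheaf.map (homOfLE _).op)
        ((Scheme.ΓSpecIso (.of A)).inv a)) =
      Ideal.Quotient.lift (I ^ (n + 1)) ((Ideal.Quotient.mk J).comp (algebraMap A (Sections f W)))
        hI ((Scheme.ΓSpecIso (.of (A ⧸ I ^ (n + 1)))).hom
          (((Scheme.ΓSpecIso (.of A)).inv ≫ (base I n).appLE ⊤ ⊤ le_top) a))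
    have e2 : (Scheme.ΓSpecIso (.of A)).inv ≫ (base I n).appLE ⊤ ⊤ le_top =
        CommRingCat.ofHom (Ideal.Quotient.mk (I ^ (n + 1))) ≫
          (Scheme.ΓSpecIso (.of (A ⧸ I ^ (n + 1)))).inv := by
      have h0 : (base I n).appLE ⊤ ⊤ le_top = (base I n).appTop :=
        (Scheme.Hom.app_eq_appLE (base I n)).symm
      rw [h0]
      exact (Scheme.ΓSpecIso_inv_naturality _).symm
    rw [e2]
    change _ = Ideal.Quotient.lift (I ^ (n + 1)) _ hI
      (((Scheme.ΓSpecIso (.of (A ⧸ I ^ (n + 1)))).inv ≫ (Scheme.ΓSpecIso _).hom)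
        (Ideal.Quotient.mk (I ^ (n + 1)) a))
    rw [Iso.inv_hom_id]
    rfl
  -- descend along the pushout and evaluate at `b`
  have hk : k₁ b = 0 := by
    have e1 : (ι I f n).appLE W ((ι I f n) ⁻¹ᵁ W ⊓ (toSpec I f n) ⁻¹ᵁ ⊤) (by simp) ≫
        hsq.desc k₁ k₂ hcomm = k₁ := hsq.inl_desc k₁ k₂ hcomm
    rw [← e1]
    change hsq.desc k₁ k₂ hcomm (((ι I f n).app W ≫
      (infinitesimalNeighbourhood I f n).presheaf.map (homOfLE _).op) b) = 0
    rw [CategoryTheory.comp_apply, hb, map_zero, map_zero]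
  exact Ideal.Quotient.eq_zero_iff_mem.mp hk

/-- In particular, for `I = (π)`: a function on an affine open `W` vanishing on `W_n` is
`π^{n+1} c` for some `c ∈ Γ(X, W)`. [folklore] -/
theorem exists_eq_pow_smul_of_app_ι_eq_zero (π : A) (n : ℕ) {W : X.Opens} (hW : IsAffineOpen W)
    (b : Sections f W) (hb : appι f (Ideal.span {π}) n W b = 0) :
    ∃ c : Sections f W, b = π ^ (n + 1) • c := by
  have h := mem_map_of_app_ι_eq_zero f (Ideal.span {π}) n hW b hb
  rw [Ideal.span_singleton_pow, Ideal.map_span, Set.image_singleton,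
    Ideal.mem_span_singleton'] at h
  obtain ⟨c, rfl⟩ := h
  exact ⟨c, by rw [Algebra.smul_def, mul_comm]⟩

end Local

/-! ### Lifting functions from `X_n`: the connecting homomorphism to `Ȟ¹` -/

section Lift

variable (π : A) {ι' : Type v} (U : ι' → X.Opens)

namespace LiftData

variable {f π U} {n : ℕ} {s : Γ(infinitesimalNeighbourhood (Ideal.span {π}) f n, ⊤)}


/-- Lift data exist (for `X` flat over `A`, `π` a non-zero-divisor and the `U_i` affine): lift
`s |_{(U_i)_n}` by the surjectivity of `Γ(X, U_i) → Γ((U_i)_n, 𝒪)` (closed immersion, affine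
`U_i`), and divide `m_j - m_i`, which vanishes on `(U_i ∩ U_j)_n`, by `π^{n+1}` (locally by
`exists_eq_pow_smul_of_app_ι_eq_zero`, globally by `Sections.exists_eq_smul_of_forall_affine`).
[folklore] -/
theorem nonempty [Flat f] (hπ : π ∈ nonZeroDivisors A) (hU : ∀ i, IsAffineOpen (U i)) (n : ℕ)
    (s : Γ(infinitesimalNeighbourhood (Ideal.span {π}) f n, ⊤)) :
    Nonempty (LiftData f π U n s) := by
  choose m hm using fun i ↦ (ι (Ideal.span {π}) f n).app_surjective (U i) (hU i)
    (resTop (infinitesimalNeighbourhood (Ideal.span {π}) f n)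
      ((ι (Ideal.span {π}) f n) ⁻¹ᵁ (U i)) s)
  have hreg : ∀ W : X.Opens, IsSMulRegular (Sections f W) (π ^ (n + 1)) := fun W ↦
    (Sections.isSMulRegular f hπ W).pow (n + 1)
  have hdiv : ∀ i j, ∃ c : Sections f (U i ⊓ U j), cechD0 f U m i j = π ^ (n + 1) • c := by
    intro i j
    refine Sections.exists_eq_smul_of_forall_affine f hreg _ fun W hW ↦ ?_
    refine exists_eq_pow_smul_of_app_ι_eq_zero f π n W.2 _ ?_
    rw [appι_res, appι_cechD0_eq_zero m hm, map_zero]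
  choose c hc using hdiv
  have hc' : π ^ (n + 1) • c = cechD0 f U m := by ext i j; exact (hc i j).symm
  -- `c` is a cocycle: `π^{n+1} d¹ c = d¹ d⁰ m = 0` and `π` is a non-zero-divisor
  have hZ : c ∈ cechZ1 f U := by
    rw [mem_cechZ1_iff]
    have h : π ^ (n + 1) • cechD1 f U c = 0 := by
      rw [← map_smul, hc', cechD1_cechD0]
    ext i j k
    have hijk := congr_fun (congr_fun (congr_fun h i) j) k
    simp only [Pi.smul_apply, Pi.zero_apply] at hijk ⊢
    exact ((Sections.isSMulRegular f hπ _).pow (n + 1)) (hijk.trans (smul_zero _).symm)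
  exact ⟨⟨m, hm, c, hc', hZ⟩⟩

variable (D : LiftData f π U n s)

/-- The class of lift data does not depend on the choices: two families of local lifts differ by
`π^{n+1} b` (`exists_eq_pow_smul_of_app_ι_eq_zero`), so the cochains differ by `d⁰ b`. [folklore] -/
theorem cls_eq [Flat f] (hπ : π ∈ nonZeroDivisors A) (hU : ∀ i, IsAffineOpen (U i))
    (D' : LiftData f π U n s) : D.cls = D'.cls := by
  -- `m'_i - m_i = π^{n+1} b_i`
  have hb : ∀ i, ∃ b : Sections f (U i), D'.m i - D.m i = π ^ (n + 1) • b := fun i ↦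
    exists_eq_pow_smul_of_app_ι_eq_zero f π n (hU i) _ (by rw [map_sub, D'.hm, D.hm, sub_self])
  choose b hb using hb
  -- hence `c' = c + d⁰ b`
  have hc : D'.c = D.c + cechD0 f U b := by
    have h1 : π ^ (n + 1) • D'.c = π ^ (n + 1) • (D.c + cechD0 f U b) := by
      rw [smul_add, D'.hc, D.hc, ← map_smul]
      have : D'.m = D.m + π ^ (n + 1) • b := by
        ext i; rw [Pi.add_apply, Pi.smul_apply, ← hb i]; abel
      rw [this, map_add]
    ext i j
    exact ((Sections.isSMulRegular f hπ _).pow (n + 1))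
      (congr_fun (congr_fun h1 i) j)
  rw [cls, cls, ← sub_eq_zero, ← map_sub, CechH1.mk_eq_zero_iff]
  change D.c - D'.c ∈ cechB1 f U
  rw [hc, sub_add_cancel_left, mem_cechB1_iff]
  exact ⟨-b, by rw [map_neg]⟩

/-- `π^{n+1}` kills the class of lift data (`π^{n+1} c = d⁰ m` is a coboundary). [folklore] -/
theorem pow_smul_cls : π ^ (n + 1) • D.cls = 0 := by
  rw [cls, ← map_smul, CechH1.mk_eq_zero_iff]
  change π ^ (n + 1) • D.c ∈ cechB1 f U
  rw [D.hc, mem_cechB1_iff]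
  exact ⟨D.m, rfl⟩

/-- If the class of lift data vanishes, `s` lifts to a global function on `X`: write
`c = d⁰ b`, replace `m_i` by `m_i - π^{n+1} b_i` (still lifts of `s |_{(U_i)_n}`), which now agree
on overlaps and glue. [folklore] -/
theorem exists_restrict_eq (hcov : ⨆ i, U i = ⊤) (h : D.cls = 0) :
    ∃ m : Γ(X, ⊤), restrict (Ideal.span {π}) f n m = s := by
  rw [cls, CechH1.mk_eq_zero_iff] at h
  obtain ⟨b, hb⟩ := (mem_cechB1_iff f U _).mp h
  change cechD0 f U b = D.c at hb
  set m' : CechC0 f U := D.m - π ^ (n + 1) • b with hm'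
  have hglue : TopCat.Presheaf.IsCompatible X.presheaf U m' := by
    intro i j
    change Sections.res f inf_le_left (m' i) = Sections.res f inf_le_right (m' j)
    rw [← sub_eq_zero]
    have : Sections.res f inf_le_right (m' j) - Sections.res f inf_le_left (m' i) =
        cechD0 f U m' i j := rfl
    rw [← neg_sub, this, hm', map_sub, map_smul, hb, ← D.hc, sub_self]
    simp
  obtain ⟨m, hm, -⟩ := X.sheaf.existsUnique_gluing' U ⊤ (fun i ↦ homOfLE le_top) hcov.ge m' hglue
  refine ⟨m, ?_⟩
  apply (infinitesimalNeighbourhood (Ideal.span {π}) f n).sheaf.eq_of_locally_eq'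
    (fun i ↦ (ι (Ideal.span {π}) f n) ⁻¹ᵁ (U i)) ⊤ (fun i ↦ homOfLE le_top)
    (by rw [← Scheme.Hom.preimage_iSup, hcov]; exact le_top)
  intro i
  change resTop _ ((ι (Ideal.span {π}) f n) ⁻¹ᵁ (U i)) ((ι (Ideal.span {π}) f n).appTop m) =
    resTop _ ((ι (Ideal.span {π}) f n) ⁻¹ᵁ (U i)) s
  have e2 : (resTop X (U i) m : Sections f (U i)) = m' i := hm i
  rw [← app_resTop, ← D.hm i]
  change appι f (Ideal.span {π}) n (U i) (resTop X (U i) m) = _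
  rw [e2, hm', Pi.sub_apply, map_sub, Pi.smul_apply, appι_pow_smul, sub_zero]

end LiftData

end Lift

/-! ### Surjectivity of `Γ(X, 𝒪)^∧ → lim Γ(X_n, 𝒪)` -/

/-- The kernel of `Γ(X, 𝒪_X) → Γ(X_n, 𝒪_{X_n})` is `π^{n+1} Γ(X, 𝒪_X)` (for `I = (π)`, `X` flat
over `A`, `π` a non-zero-divisor): locally this is `exists_eq_pow_smul_of_app_ι_eq_zero`, and
the local quotients glue (`Sections.exists_eq_smul_of_forall_affine`). [folklore] -/
theorem mem_map_of_restrict_eq_zero [Flat f] {π : A} (hπ : π ∈ nonZeroDivisors A) (n : ℕ)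
    (b : Γ(X, ⊤)) (hb : restrict (Ideal.span {π}) f n b = 0) :
    b ∈ (Ideal.span {π} ^ (n + 1)).map (algebraMapΓ f) := by
  have hreg : ∀ W : X.Opens, IsSMulRegular (Sections f W) (π ^ (n + 1)) := fun W ↦
    (Sections.isSMulRegular f hπ W).pow (n + 1)
  obtain ⟨c, hc⟩ := Sections.exists_eq_smul_of_forall_affine f hreg (V := ⊤) (b : Sections f ⊤)
    fun W hW ↦ by
      refine exists_eq_pow_smul_of_app_ι_eq_zero f π n W.2 _ ?_
      change ((X.presheaf.map (homOfLE hW).op) ≫ (ι (Ideal.span {π}) f n).app W) b = 0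
      rw [(ι (Ideal.span {π}) f n).naturality]
      change (infinitesimalNeighbourhood (Ideal.span {π}) f n).presheaf.map _
        (restrict (Ideal.span {π}) f n b) = 0
      rw [hb, map_zero]
  rw [Ideal.span_singleton_pow, Ideal.map_span, Set.image_singleton, Ideal.mem_span_singleton']
  refine ⟨c, ?_⟩
  have : (homOfLE (le_top : (⊤ : X.Opens) ≤ ⊤)).op = 𝟙 (op ⊤) := Subsingleton.elim _ _
  rw [hc, Algebra.smul_def, mul_comm]
  congr 1
  change _ = X.presheaf.map (homOfLE (le_top : (⊤ : X.Opens) ≤ ⊤)).op (algebraMapΓ f (π ^ (n + 1)))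
  rw [this, X.presheaf.map_id]
  rfl

/-- **Injectivity of `Γ(X, 𝒪_X)^∧ → lim_n Γ(X_n, 𝒪_{X_n})` for flat `X` and `I = (π)`**, `π` a
non-zero-divisor: `HasInjectiveFormalFunctions (π) f` — a global function vanishing on `X_n` lies
in `π^{n+1} Γ(X, 𝒪_X)` (`mem_map_of_restrict_eq_zero`); no finiteness is needed for this half of
the theorem on formal functions (Stacks Project, Tag 02OC, case `p = 0`, `𝓕 = 𝒪_X`). [cite: StacksProject, Tag 02OC (Cohomology of Schemes, Theorem 30.20.5, case p = 0, F = O_X)] -/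
theorem hasInjectiveFormalFunctions_of_flat [Flat f] {π : A} (hπ : π ∈ nonZeroDivisors A) :
    HasInjectiveFormalFunctions (Ideal.span {π}) f :=
  fun m _ h0 n ↦ mem_map_of_restrict_eq_zero f hπ n (m n) (h0 n)

/-- **Surjectivity of `Γ(X, 𝒪_X)^∧ → lim_n Γ(X_n, 𝒪_{X_n})` from the finiteness of `Ȟ¹`.** Let `A`
be Noetherian, `π ∈ A` a non-zero-divisor, `f : X → Spec A` flat, and `𝒰 = (U_i)` an affine open
cover of `X` with `Ȟ¹(𝒰, 𝒪_X)` a finitely generated `A`-module. Then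
`HasSurjectiveFormalFunctions (π) f`: every family `s_n ∈ Γ(X_n, 𝒪)`, `X_n = X ×_A A/π^{n+1}`,
compatible under restriction comes from a `π`-adic Cauchy sequence of global functions on `X`
(the case `p = 0`, `𝓕 = 𝒪_X`, `I = (π)` of the theorem on formal functions, Stacks Project,
Tag 02OC, for flat `X`, from the finiteness of `H¹` alone). See the module docstring for the
proof. [cite: StacksProject, Tag 02OC (Cohomology of Schemes, Theorem 30.20.5, case p = 0, F = O_X)] -/
theorem hasSurjectiveFormalFunctions_of_finite_cechH1 [IsNoetherianRing A] [Flat f] {π : A}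
    (hπ : π ∈ nonZeroDivisors A) {ι' : Type v} (U : ι' → X.Opens)
    (hU : ∀ i, IsAffineOpen (U i)) (hcov : ⨆ i, U i = ⊤) (hfin : Module.Finite A (CechH1 f U)) :
    HasSurjectiveFormalFunctions (Ideal.span {π}) f := by
  intro s hs
  -- torsion bound: `π^e` kills all `π`-power torsion of the Noetherian module `Ȟ¹`
  haveI : IsNoetherian A (CechH1 f U) := isNoetherian_of_isNoetherianRing_of_finite A _
  let F : ℕ →o Submodule A (CechH1 f U) :=
    ⟨fun k ↦ Submodule.torsionBy A (CechH1 f U) (π ^ k), fun k l hkl x hx ↦ by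
      simp only [Submodule.mem_torsionBy_iff] at hx ⊢
      obtain ⟨d, rfl⟩ := Nat.exists_eq_add_of_le hkl
      rw [add_comm, pow_add, mul_smul, hx, smul_zero]⟩
  obtain ⟨e, he⟩ := (monotone_stabilizes_iff_noetherian.mpr ‹IsNoetherian A (CechH1 f U)›) F
  -- lift data and classes `x n`
  have D : ∀ n, LiftData f π U n (s n) := fun n ↦ (LiftData.nonempty hπ hU n (s n)).some
  set x : ∀ n, CechH1 f U := fun n ↦ (D n).cls with hx
  have hxsucc : ∀ n, x n = π • x (n + 1) := fun n ↦ by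
    rw [hx]
    change (D n).cls = π • (D (n + 1)).cls
    rw [← LiftData.cls_ofSucc (D (n + 1)) (hs n)]
    exact LiftData.cls_eq (D n) hπ hU _
  have hxadd : ∀ j n, x n = π ^ j • x (n + j) := by
    intro j
    induction j with
    | zero => intro n; simp
    | succ j ih => intro n; rw [ih n, hxsucc (n + j), smul_smul, ← pow_succ, Nat.add_assoc]
  have htors : ∀ n, x n ∈ Submodule.torsionBy A (CechH1 f U) (π ^ (n + 1)) := fun n ↦
    (Submodule.mem_torsionBy_iff _ _).mpr (LiftData.pow_smul_cls (D n))
  have hx0 : ∀ n, x n = 0 := by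
    intro n
    rw [hxadd e n]
    have h1 : x (n + e) ∈ F (n + e + 1) := htors (n + e)
    rw [← he (n + e + 1) (by omega)] at h1
    exact (Submodule.mem_torsionBy_iff _ _).mp h1
  -- hence every `s n` lifts
  choose m hm using fun n ↦ LiftData.exists_restrict_eq (D n) hcov (hx0 n)
  refine ⟨m, fun n ↦ ?_, hm⟩
  -- and the lifts form a Cauchy sequence
  apply mem_map_of_restrict_eq_zero f hπ n
  rw [map_sub, hm n, sub_eq_zero, ← hs n, ← hm (n + 1), transition_appTop_restrict]

/-- **Surjectivity of `Γ(X, 𝒪_X)^∧ → lim_n Γ(X_n, 𝒪_{X_n})` for proper flat `X` over a Noetherian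
ring, from the named fact `cechH1_finite`** (Stacks Project, Tag 02O5: `H¹(X, 𝒪_X)` is a finite
`A`-module): `HasSurjectiveFormalFunctions (π) f` for `f : X → Spec A` proper and flat and `π` a
non-zero-divisor of `A`, by `hasSurjectiveFormalFunctions_of_finite_cechH1` applied to a finite
affine open cover of the quasi-compact `X`. [cite: StacksProject, Tags 02O5 and 02OC (Cohomology of Schemes, Proposition 30.19.1 and Theorem 30.20.5)] -/
theorem hasSurjectiveFormalFunctions_of_cechH1_finite (h : cechH1_finite.{u}) [IsNoetherianRing A]
    [IsProper f] [Flat f] {π : A} (hπ : π ∈ nonZeroDivisors A) :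
    HasSurjectiveFormalFunctions (Ideal.span {π}) f := by
  -- a finite affine open cover of `X`
  haveI : CompactSpace X := QuasiCompact.compactSpace_of_compactSpace f
  obtain ⟨T, hT, hcov⟩ := (isCompact_iff_finite_and_eq_biUnion_affineOpens (U := (⊤ : X.Opens))).mp
    (CompactSpace.isCompact_univ (X := X))
  haveI : Finite T := hT.to_subtype
  let U : T → X.Opens := fun i ↦ (i.1 : X.Opens)
  have hU : ∀ i, IsAffineOpen (U i) := fun i ↦ i.1.2
  have hcov' : ⨆ i, U i = ⊤ := by
    change ⨆ i : T, ((i.1 : X.affineOpens) : X.Opens) = ⊤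
    rw [iSup_subtype'', ← hcov]
  -- `T : Set X.affineOpens` lives in `Type u`
  exact hasSurjectiveFormalFunctions_of_finite_cechH1 f hπ U hU hcov' (h f U hU hcov')

/-- **The theorem on formal functions for `H⁰`, case `I = (π)`, `X` proper and flat**, from the
named fact `cechH1_finite` (Stacks Project, Tag 02O5): both halves
`HasSurjectiveFormalFunctions (π) f ∧ HasInjectiveFormalFunctions (π) f` of the instance of
`formalFunctions_H0` (Tag 02OC, `p = 0`, `𝓕 = 𝒪_X`) for `f : X → Spec A` proper and flat over a
Noetherian ring and `π` a non-zero-divisor. [cite: StacksProject, Tags 02O5 and 02OC (Cohomology of Schemes, Proposition 30.19.1 and Theorem 30.20.5)] -/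
theorem formalFunctions_H0_of_cechH1_finite (h : cechH1_finite.{u}) [IsNoetherianRing A]
    [IsProper f] [Flat f] {π : A} (hπ : π ∈ nonZeroDivisors A) :
    HasSurjectiveFormalFunctions (Ideal.span {π}) f ∧
      HasInjectiveFormalFunctions (Ideal.span {π}) f :=
  ⟨hasSurjectiveFormalFunctions_of_cechH1_finite f h hπ, hasInjectiveFormalFunctions_of_flat f hπ⟩

end Literature.AlgebraicGeometry.Morphisms


namespace Literature.AlgebraicGeometry.Morphisms

/-! ### The affine case

For `X` affine the theorem on formal functions for `H⁰` is elementary and needs no hypothesis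
on `A`, `I` or `f`: `X_n = Spec (Γ(X, 𝒪_X) ⊗_A A/I^{n+1})`, so `Γ(X, 𝒪_X) → Γ(X_n, 𝒪_{X_n})` is
surjective (a closed immersion into an affine scheme) with kernel `I^{n+1} Γ(X, 𝒪_X)`
(`mem_map_of_app_ι_eq_zero` for the affine open `W = X`), i.e. `lim_n Γ(X_n, 𝒪_{X_n})` *is* the
`I`-adic completion of `Γ(X, 𝒪_X)`. We record both halves of the spelled-out statement,
`HasSurjectiveFormalFunctions I f` and `HasInjectiveFormalFunctions I f` (predicates on the data
`(I, f)`, see `FormalFunctions.lean`), in this case, and the bijectivity of the canonical map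
`toFormalSections I f : Γ(X, 𝒪_X)^∧ → lim_n Γ(X_n, 𝒪_{X_n})`. -/

section Affine

open infinitesimalNeighbourhood

variable {A : Type u} [CommRing A] (I : Ideal A) {X : Scheme.{u}} (f : X ⟶ Spec (.of A))

/-- For affine `X`, a global function vanishing on `X_n = X ×_A A/I^{n+1}` lies in
`I^{n+1} Γ(X, 𝒪_X)` (`mem_map_of_app_ι_eq_zero` for the affine open `W = X`). [folklore] -/
theorem mem_map_of_restrict_eq_zero_of_isAffine [IsAffine X] (n : ℕ) (b : Γ(X, ⊤))
    (hb : restrict I f n b = 0) : b ∈ (I ^ (n + 1)).map (algebraMapΓ f) := by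
  have h := mem_map_of_app_ι_eq_zero f I n (isAffineOpen_top X) (b : Sections f ⊤)
    (show ((ι I f n).app ⊤).hom b = 0 from hb)
  have e : (I ^ (n + 1)).map (algebraMap A (Sections f ⊤)) =
      ((I ^ (n + 1)).map (algebraMapΓ f)).map (resTop X ⊤) := by
    rw [Ideal.map_map]
    rfl
  have hid : resTop X ⊤ = RingHom.id Γ(X, ⊤) := RingHom.ext (resTop_top X)
  rw [e, hid, Ideal.map_id] at h
  exact h

/-- **Surjectivity of `Γ(X, 𝒪_X)^∧ → lim_n Γ(X_n, 𝒪_{X_n})` for affine `X`** (any `A`, `I`, `f`):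
`HasSurjectiveFormalFunctions I f` — each `Γ(X, 𝒪_X) → Γ(X_n, 𝒪_{X_n})` is surjective (closed
immersion into the affine scheme `X`, Mathlib `Scheme.Hom.app_surjective`) and arbitrary lifts of
a compatible family form an `I`-adic Cauchy sequence by
`mem_map_of_restrict_eq_zero_of_isAffine`. [folklore] -/
theorem hasSurjectiveFormalFunctions_of_isAffine [IsAffine X] :
    HasSurjectiveFormalFunctions I f := by
  intro s hs
  have hsurj : ∀ n, Function.Surjective (restrict I f n) := fun n ↦
    (ι I f n).app_surjective ⊤ (isAffineOpen_top X)
  choose m hm using fun n ↦ hsurj n (s n)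
  refine ⟨m, fun n ↦ ?_, hm⟩
  apply mem_map_of_restrict_eq_zero_of_isAffine I f n
  rw [map_sub, hm n, sub_eq_zero, ← hs n, ← hm (n + 1), transition_appTop_restrict]

/-- **Injectivity of `Γ(X, 𝒪_X)^∧ → lim_n Γ(X_n, 𝒪_{X_n})` for affine `X`** (any `A`, `I`, `f`):
`HasInjectiveFormalFunctions I f`, immediate from `mem_map_of_restrict_eq_zero_of_isAffine`.
[folklore] -/
theorem hasInjectiveFormalFunctions_of_isAffine [IsAffine X] :
    HasInjectiveFormalFunctions I f :=
  fun m _ h0 n ↦ mem_map_of_restrict_eq_zero_of_isAffine I f n (m n) (h0 n)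

/-- **The theorem on formal functions for `H⁰` in the affine case**: for affine `X` (any ring
`A`, ideal `I` and `f : X → Spec A`) the canonical ring homomorphism
`Γ(X, 𝒪_X)^∧ → lim_n Γ(X_n, 𝒪_{X_n})` (`toFormalSections I f`) is bijective. [folklore] -/
theorem bijective_toFormalSections_of_isAffine [IsAffine X] :
    Function.Bijective (toFormalSections I f) :=
  ⟨(hasInjectiveFormalFunctions_iff_injective I f).mp (hasInjectiveFormalFunctions_of_isAffine I f),
    (hasSurjectiveFormalFunctions_iff_surjective I f).mp
      (hasSurjectiveFormalFunctions_of_isAffine I f)⟩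

end Affine

end Literature.AlgebraicGeometry.Morphisms

end
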